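import Literature.Barriers.BirchSwinnertonDyer.RankNotSumOfLocalInvariantsNarrowTwists
import HarnessLib

/-!
# The NARROWED record `…_rankMod_notSumOfLocalInvariantsNarrow` from the three descent leaves

Companion to `Literature/Barriers/BirchSwinnertonDyer/RankNotSumOfLocalInvariants.lean` (§ Audit
2026-08-15) and sequel of `RankNotSumOfLocalInvariantsNarrowTwists.lean`. The NARROWED barrier
record `Literature.Barriers.BirchSwinnertonDyer.DokchitserDokchitser2011_rankMod_notSumOfLocalInvariantsNarrow`
is the conjunction of

1. the entry `DokchitserDokchitser2011_rankMod_notSumOfLocalInvariants` (T. Dokchitser–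
   V. Dokchitser, *A note on the Mordell–Weil rank modulo `n`*, J. Number Theory 131 (2011),
   Thm. 2: for `n ∈ {3, 4, 5}` the rank modulo `n` is not a sum of local invariants, ONE `λ` for
   all number fields), which the tree reduces to the three named descent facts
   `DokchitserDokchitser2011_rank_480a1_F3/_F4/_F5` ("2-descent shows that `rk E/F₃ = rk E/F₅ = 1`
   and `rk E/F₄ = 6`", `E = 480a1`; `RankNotSumOfLocalInvariantsProofs.lean`,
   `DokchitserDokchitser2011_rankMod_notSumOfLocalInvariants_of_descent`), and
2. its face over the FIXED field `ℚ` modulo `4`: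
   `¬ IsSumOfLocalInvariantsOver ℚ (fun W ↦ (W.mordellWeilRank : ZMod 4))`, by Lemma 5 of loc. cit.
   with `K = ℚ`, `F = F₄ = ℚ(√-1, √41, √73)`, `E = 480a1`: the ranks over `ℚ` of the eight quadratic
   twists `E_D`, `D ∈ ⟨-1, 41, 73⟩`, add up to `rk E(F₄) = 6 ≢ 0 (mod 4)`.

This file PROVES conjunct (2) from the `F₄` leaf ALONE and assembles the record from the SAME
three named facts as the entry — no further hypothesis:

* `not_isSumOfLocalInvariantsOver_rat_of_sum_twist_ne_zero`: **Lemma 5 for `(ℚ, F₄, 480a1)`,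
  proved** — the eight twists `DokchitserDokchitser2011.twist` fall into `4`-blocks of isomorphic
  curves at every finite place `ℚ_v` (squares transported from `ℚ_[p]` along Mathlib's
  `Rat.HeightOneSpectrum.adicCompletion.padicEquiv`) and at the real place (`ℝ ≅ ℚ_∞`,
  `NumberField.InfinitePlace.Completion.ringEquivRealOfIsReal`), so every `ℤ/nℤ`-valued (`n ∣ 4`)
  additive local formula over `ℚ` sums to `0` over them (barrier file,
  `not_isSumOfLocalInvariantsOver_of_blocks`).
* `DokchitserDokchitser2011.sum_mordellWeilRank_twist_eq_six`: granting the concrete leaf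
  `DokchitserDokchitser2011_descent_480a1_F4` (`rk E(F₄) = 6` for the tower model `F4`),
  `Σ_D rk E^{(d(D))}(ℚ) = 6` — by the rank formula for quadratic extensions
  `rank_ℤ E(L(√c)) = rank_ℤ E(L) + rank_ℤ E^{(c)}(L)` (Silverman AEC Exercise 10.16; tree
  `WeierstrassCurve.rank_point_baseChange_quadraticAlgebra`, and `rank_point_F4_eq` of
  `RankNotSumOfLocalInvariantsF4Twists.lean`) applied once more along `ℚ(√-1)/ℚ`, and
  `E ≅ E^{(1)}` (tree `VariableChange.finrank_point_variableChange`).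
* `DokchitserDokchitser2011_descent_480a1_F4_of_rank` (and `…_iff_rank`): the concrete leaf is
  EQUIVALENT to the tree's existential fact `DokchitserDokchitser2011_rank_480a1_F4` — a Galois
  number field of degree `8` containing `√-1, √41, √73` receives an embedding of the splitting field
  `F4` of `(X² + 1)(X² - 41)(X² - 73)` (Mathlib `Polynomial.IsSplittingField.lift`), bijective by
  degrees, and Mordell–Weil ranks are transported along the induced isomorphism of point groups
  (Mathlib `WeierstrassCurve.Affine.Point.map`).
* `not_isSumOfLocalInvariantsOver_rat_rankMod_four_of_rank`: conjunct (2) from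
  `DokchitserDokchitser2011_rank_480a1_F4`.
* `DokchitserDokchitser2011_rankMod_notSumOfLocalInvariantsNarrow_of_descent`: **the NARROWED
  record from `DokchitserDokchitser2011_rank_480a1_F3`, `…_F4`, `…_F5`** — the same hypotheses as the
  entry's `…_of_descent`; `…_of_entry_of_rank` is the variant from the entry plus the `F₄` fact,
  `…_iff` the unfolding. The discharge `…Narrow_holds` therefore waits exactly on the three descent
  leaves (the Magma computations of the source), like the entry itself.

Design notes.
* Point groups carry Mathlib's `AddCommGroup` structure for the CLASSICAL `DecidableEq` instance,
  as baked into `WeierstrassCurve.mordellWeilRank`; the derived `DecidableEq` of `QuadraticAlgebra`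
  is disabled as in `RankNotSumOfLocalInvariantsF4Twists.lean`. The remaining instance mismatches
  (`DecidableEq ℚ`; the two `Algebra ℚ K1` structures `DivisionRing.toRatAlgebra` and
  `QuadraticAlgebra.instAlgebra`, equal by `algebra_rat_subsingleton`) are discharged by
  `convert`/`congr!`, never by new instances.
* Finiteness of the eight ranks is read off `Σ = 6` (each summand is `≤ 6 < ℵ₀`); the Mordell–Weil
  theorem is not invoked.

## References

* T. Dokchitser, V. Dokchitser, *A note on the Mordell–Weil rank modulo `n`*, J. Number Theory
  131 (2011) 1833–1839, arXiv:0910.4588: Thm. 2 and its proof, Lemma 5 with proof (p. 3 of the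
  held arXiv copy). [DokchitserDokchitser2011RankModN]
* J. H. Silverman, *The Arithmetic of Elliptic Curves*, 2nd ed., GTM 106 (2009): Exercise 10.16
  (`rank E(K(√D)) = rank E(K) + rank E_D(K)`, p. 309 of the held copy), X.5 Prop. 5.4,
  III.3.1(b). [SilvermanAEC2009]
-/

noncomputable section

attribute [-instance] instDecidableEqQuadraticAlgebra

open scoped Classical

namespace Literature.Barriers.BirchSwinnertonDyer

namespace DokchitserDokchitser2011

open WeierstrassCurve

/-! ### Transport of local squares to the completions of `ℚ` -/

section Completions

open IsDedekindDomain NumberField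

/-- Squares are transported along ring homomorphisms of fields. [folklore] -/
theorem ker_isSquare_map {K K' : Type*} [Field K] [Field K'] (f : K →+* K') {c : TwistIdx}
    (h : ∀ D, chi c D = 0 → IsSquare ((twistParam D : ℤ) : K)) (D : TwistIdx)
    (hD : chi c D = 0) : IsSquare ((twistParam D : ℤ) : K') := by
  obtain ⟨s, hs⟩ := h D hD
  exact ⟨f s, by rw [← map_mul, ← hs, map_intCast]⟩

/-- **Finite places**: over `ℚ_v = v.adicCompletion ℚ` the kernel of some character `χ_c` of the
index group consists of `D` with `d(D) ∈ ℚ_v^{×2}` — from `padic_ker_isSquare` at the prime `p`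
under `v`, along Mathlib's `ℚ_[p] ≃ ℚ_v` (`Rat.HeightOneSpectrum.adicCompletion.padicEquiv`).
[folklore] -/
theorem adicCompletion_ker_isSquare (v : HeightOneSpectrum (𝓞 ℚ)) :
    ∃ c : TwistIdx, ∀ D, chi c D = 0 → IsSquare ((twistParam D : ℤ) : v.adicCompletion ℚ) := by
  haveI : Fact ((Rat.HeightOneSpectrum.primesEquiv (R := 𝓞 ℚ) v : ℕ)).Prime :=
    ⟨(Rat.HeightOneSpectrum.primesEquiv (R := 𝓞 ℚ) v).2⟩
  let f : ℚ_[(Rat.HeightOneSpectrum.primesEquiv (R := 𝓞 ℚ) v : ℕ)] →+* v.adicCompletion ℚ :=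
    (Rat.HeightOneSpectrum.adicCompletion.padicEquiv (R := 𝓞 ℚ) v).symm.toAlgEquiv.toRingEquiv.toRingHom
  obtain ⟨c, hc⟩ := padic_ker_isSquare (Rat.HeightOneSpectrum.primesEquiv (R := 𝓞 ℚ) v : ℕ)
  exact ⟨c, ker_isSquare_map f hc⟩

/-- **The infinite place**: over `w.Completion ≅ ℝ`
(`NumberField.InfinitePlace.Completion.ringEquivRealOfIsReal`; `ℚ` is totally real) the kernel
`⟨41, 73⟩` of `χ_{(1,0,0)}` consists of squares. [folklore] -/
theorem infinitePlace_ker_isSquare (w : InfinitePlace ℚ) :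
    ∃ c : TwistIdx, ∀ D, chi c D = 0 → IsSquare ((twistParam D : ℤ) : w.Completion) := by
  let f : ℝ →+* w.Completion :=
    (InfinitePlace.Completion.ringEquivRealOfIsReal (IsTotallyReal.isReal w)).symm.toRingHom
  obtain ⟨c, hc⟩ := real_ker_isSquare
  exact ⟨c, ker_isSquare_map f hc⟩

end Completions

end DokchitserDokchitser2011

open DokchitserDokchitser2011

/-- **Lemma 5 of Dokchitser–Dokchitser (2011) for `K = ℚ`, `F = F₄ = ℚ(√-1, √41, √73)`,
`E = 480a1` — PROVED.** A `ℤ/nℤ`-valued (`n ∣ 4`) invariant `Λ` of Weierstrass curves over `ℚ`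
which is a sum of local invariants over the places of `ℚ` (`IsSumOfLocalInvariantsOver ℚ Λ`)
satisfies `Σ_D Λ(E^{(d(D))}) = 0`, the sum over the eight twists `DokchitserDokchitser2011.twist`
("`Λ(E/K) + Σ_D Λ(E_D/K) = 0`, where the sum is taken over the quadratic subfields `K(√D)` of
`F/K`, and `E_D` denotes the quadratic twist of `E` by `D`"); stated contrapositively. Proof as
printed — "in the local expression for the left-hand side of the formula each local term (`λ` of
a given elliptic curve over a given local field) occurs a multiple of `2^k` times": at every
finite place (`adicCompletion_ker_isSquare`) and at the infinite place
(`infinitePlace_ker_isSquare`) the twists fall into `4`-blocks of isomorphic curves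
(`exists_blocks`), and the barrier file's `not_isSumOfLocalInvariantsOver_of_blocks` counts.
[cite: DokchitserDokchitser2011RankModN, Lemma 5] -/
theorem not_isSumOfLocalInvariantsOver_rat_of_sum_twist_ne_zero {n : ℕ} (hn : n ∣ 4)
    (Λ : WeierstrassCurve ℚ → ZMod n) (hΛ : ∑ D, Λ (twist D) ≠ 0) :
    ¬ IsSumOfLocalInvariantsOver ℚ Λ :=
  not_isSumOfLocalInvariantsOver_of_blocks ℚ Λ twist
    (fun v ↦ by convert exists_blocks hn (adicCompletion_ker_isSquare v))
    (fun w ↦ by convert exists_blocks hn (infinitePlace_ker_isSquare w)) hΛ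

namespace DokchitserDokchitser2011

open WeierstrassCurve

/-! ### The eight Mordell–Weil ranks over `ℚ` from `rk E(F₄) = 6` -/

/-- **The `ℚ(√-1)/ℚ` step**: for every `W/ℚ`, `rank_ℤ W(K1) = rank_ℤ W(ℚ) + rank_ℤ W^{(-1)}(ℚ)`
(`K1 = ℚ(√-1)`; Silverman AEC Exercise 10.16, tree
`WeierstrassCurve.rank_point_baseChange_quadraticAlgebra` with `c = -1`; the two `ℚ`-algebra
structures on `K1` agree, `algebra_rat_subsingleton`). [cite: SilvermanAEC2009, Exercise 10.16] -/
theorem rank_point_K1_eq_add (W : WeierstrassCurve ℚ) :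
    Module.rank ℤ (W.baseChange K1).toAffine.Point =
      Module.rank ℤ W.toAffine.Point + Module.rank ℤ (W.quadraticTwist (-1)).toAffine.Point := by
  convert rank_point_baseChange_quadraticAlgebra (-1 : ℚ) W <;> rfl

/-- **`rank_ℤ E(F₄)` is the sum of the eight cardinal ranks over `ℚ`** of `E`, `E^{(-1)}`,
`E^{(±41)}`, `E^{(±73)}`, `E^{(±2993)}` (`E = 480a1`): `rank_point_F4_eq` (the four twists over
`K1`) followed by the `K1/ℚ` step and `(E^{(a)})^{(-1)} = E^{(-a)}`
(`WeierstrassCurve.quadraticTwist_quadraticTwist`). "2-descent […] over all minimal non-trivial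
subfields" read over `ℚ`. [cite: DokchitserDokchitser2011RankModN, proof of Thm. 2] -/
theorem rank_point_F4_eq_sum_eight :
    Module.rank ℤ (curve480a1.baseChange F4).toAffine.Point =
      Module.rank ℤ curve480a1.toAffine.Point +
        Module.rank ℤ (curve480a1.quadraticTwist (-1)).toAffine.Point +
      (Module.rank ℤ (curve480a1.quadraticTwist 41).toAffine.Point +
        Module.rank ℤ (curve480a1.quadraticTwist (-41)).toAffine.Point) +
      (Module.rank ℤ (curve480a1.quadraticTwist 73).toAffine.Point +
        Module.rank ℤ (curve480a1.quadraticTwist (-73)).toAffine.Point) +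
      (Module.rank ℤ (curve480a1.quadraticTwist 2993).toAffine.Point +
        Module.rank ℤ (curve480a1.quadraticTwist (-2993)).toAffine.Point) := by
  rw [rank_point_F4_eq, rank_point_K1_eq_add, rank_point_K1_eq_add, rank_point_K1_eq_add,
    rank_point_K1_eq_add, quadraticTwist_quadraticTwist, quadraticTwist_quadraticTwist,
    quadraticTwist_quadraticTwist, show (41 : ℚ) * -1 = -41 by norm_num,
    show (73 : ℚ) * -1 = -73 by norm_num, show (2993 : ℚ) * -1 = -2993 by norm_num]

/-- A point group over `ℚ` of finite `ℤ`-rank has `Module.rank = mordellWeilRank`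
(`mordellWeilRank = finrank = toNat ∘ rank`). [folklore] -/
theorem rank_point_eq_mordellWeilRank (W : WeierstrassCurve ℚ)
    (h : Module.rank ℤ W.toAffine.Point < Cardinal.aleph0) :
    Module.rank ℤ W.toAffine.Point = W.mordellWeilRank := by
  unfold WeierstrassCurve.mordellWeilRank Module.finrank
  rw [Cardinal.cast_toNat_of_lt_aleph0]
  · congr!
  · convert h

/-- `rk E^{(1)}(ℚ) = rk E(ℚ)`: the twist by `1` is `ℚ`-isomorphic to `E`
(`WeierstrassCurve.exists_variableChange_quadraticTwist_one`), and the rank is an isomorphism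
invariant (Silverman AEC III.3.1(b); tree `VariableChange.finrank_point_variableChange`).
[cite: SilvermanAEC2009, III.3.1(b)] -/
theorem mordellWeilRank_quadraticTwist_one :
    (curve480a1.quadraticTwist 1).mordellWeilRank = curve480a1.mordellWeilRank := by
  obtain ⟨C, hC⟩ := curve480a1.exists_variableChange_quadraticTwist_one
  rw [← hC]
  unfold WeierstrassCurve.mordellWeilRank
  convert VariableChange.finrank_point_variableChange curve480a1 C

/-- Eight cardinals summing to `6` are all finite. [folklore] -/
theorem lt_aleph0_of_sum_eight_eq_six {a b c d e f g h : Cardinal}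
    (hs : a + b + (c + d) + (e + f) + (g + h) = 6) :
    a < Cardinal.aleph0 ∧ b < Cardinal.aleph0 ∧ c < Cardinal.aleph0 ∧ d < Cardinal.aleph0 ∧
      e < Cardinal.aleph0 ∧ f < Cardinal.aleph0 ∧ g < Cardinal.aleph0 ∧ h < Cardinal.aleph0 := by
  have h6 : (6 : Cardinal) < Cardinal.aleph0 := Cardinal.natCast_lt_aleph0
  have fin : ∀ {x : Cardinal}, x ≤ 6 → x < Cardinal.aleph0 := fun hx ↦ hx.trans_lt h6
  refine ⟨fin ?_, fin ?_, fin ?_, fin ?_, fin ?_, fin ?_, fin ?_, fin ?_⟩ <;> rw [← hs]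
  · exact le_add_of_le_left (le_add_of_le_left (le_add_of_le_left le_self_add))
  · exact le_add_of_le_left (le_add_of_le_left (le_add_of_le_left le_add_self))
  · exact le_add_of_le_left (le_add_of_le_left (le_add_of_le_right le_self_add))
  · exact le_add_of_le_left (le_add_of_le_left (le_add_of_le_right le_add_self))
  · exact le_add_of_le_left (le_add_of_le_right le_self_add)
  · exact le_add_of_le_left (le_add_of_le_right le_add_self)
  · exact le_add_of_le_right le_self_add
  · exact le_add_of_le_right le_add_self

/-- **The eight ranks over `ℚ` add up to `6`**, granting the descent leaf
`DokchitserDokchitser2011_descent_480a1_F4` (`rk E(F₄) = 6`): `rank_point_F4_eq_sum_eight`, read in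
`ℕ` (each summand is `≤ 6`, hence finite and equal to the `mordellWeilRank`).
[cite: DokchitserDokchitser2011RankModN, proof of Thm. 2] -/
theorem sum_eight_mordellWeilRank_eq_six (h₄ : DokchitserDokchitser2011_descent_480a1_F4) :
    curve480a1.mordellWeilRank +
        (curve480a1.quadraticTwist (-1)).mordellWeilRank +
      ((curve480a1.quadraticTwist 41).mordellWeilRank +
        (curve480a1.quadraticTwist (-41)).mordellWeilRank) +
      ((curve480a1.quadraticTwist 73).mordellWeilRank +
        (curve480a1.quadraticTwist (-73)).mordellWeilRank) +
      ((curve480a1.quadraticTwist 2993).mordellWeilRank +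
        (curve480a1.quadraticTwist (-2993)).mordellWeilRank) = 6 := by
  have h6 : Module.rank ℤ (curve480a1.baseChange F4).toAffine.Point = 6 := by
    have h := h₄
    unfold DokchitserDokchitser2011_descent_480a1_F4 WeierstrassCurve.mordellWeilRank
      Module.finrank at h
    exact_mod_cast (Cardinal.toNat_eq_iff (by norm_num)).mp h
  rw [rank_point_F4_eq_sum_eight] at h6
  obtain ⟨ha, hb, hc, hd, he, hf, hg, hh⟩ := lt_aleph0_of_sum_eight_eq_six h6
  rw [rank_point_eq_mordellWeilRank _ ha, rank_point_eq_mordellWeilRank _ hb,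
    rank_point_eq_mordellWeilRank _ hc, rank_point_eq_mordellWeilRank _ hd,
    rank_point_eq_mordellWeilRank _ he, rank_point_eq_mordellWeilRank _ hf,
    rank_point_eq_mordellWeilRank _ hg, rank_point_eq_mordellWeilRank _ hh] at h6
  exact_mod_cast h6

/-- **`Σ_D rk E^{(d(D))}(ℚ) = rk E(F₄) = 6`** over the family `DokchitserDokchitser2011.twist`,
granting the descent leaf `DokchitserDokchitser2011_descent_480a1_F4` ("2-descent shows that
`rk E/F₄ = 6`"). [cite: DokchitserDokchitser2011RankModN, proof of Thm. 2] -/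
theorem sum_mordellWeilRank_twist_eq_six (h₄ : DokchitserDokchitser2011_descent_480a1_F4) :
    ∑ D : TwistIdx, (twist D).mordellWeilRank = 6 := by
  rw [← sum_eight_mordellWeilRank_eq_six h₄, ← mordellWeilRank_quadraticTwist_one]
  simp only [Fintype.sum_prod_type, Fin.sum_univ_two, twist, twistParam, Fin.isValue]
  norm_num
  ring

end DokchitserDokchitser2011

/-! ### The concrete descent leaf from the existential `F₄` fact -/

section Existential

open Polynomial WeierstrassCurve

/-- **`DokchitserDokchitser2011_descent_480a1_F4` from `DokchitserDokchitser2011_rank_480a1_F4`**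
(converse of `DokchitserDokchitser2011_rank_480a1_F4_of_descent`; the two named facts are
equivalent, `…_iff_rank`). A number field `F` of degree `8` containing `a² = -1`, `b² = 41`,
`c² = 73` splits `F4.poly = (X² + 1)(X² - 41)(X² - 73)`, so the splitting field `F4` embeds into
`F` (Mathlib `Polynomial.IsSplittingField.lift`), bijectively since `[F4 : ℚ] = 8 = [F : ℚ]`;
along the induced isomorphism of point groups `E(F4) ≃+ E(F)` (Mathlib
`WeierstrassCurve.Affine.Point.map`) the Mordell–Weil ranks of `E = 480a1` agree.
[cite: DokchitserDokchitser2011RankModN, proof of Thm. 2] -/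
theorem DokchitserDokchitser2011_descent_480a1_F4_of_rank
    (h : DokchitserDokchitser2011_rank_480a1_F4) : DokchitserDokchitser2011_descent_480a1_F4 := by
  obtain ⟨F, _, _, _, hdeg, ⟨a, b, c, ha, hb, hc⟩, -, -, hr⟩ := h
  -- `F4.poly` splits in `F`
  have hs : Splits (F4.poly.map (algebraMap ℚ F)) := by
    have e : F4.poly.map (algebraMap ℚ F) =
        (X ^ 2 - C (-1)) * (X ^ 2 - C 41) * (X ^ 2 - C 73) := by
      simp only [F4.poly, Polynomial.map_mul, Polynomial.map_sub, Polynomial.map_pow, map_X,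
        map_C, eq_ratCast, Rat.cast_neg, Rat.cast_one, Rat.cast_ofNat]
    rw [e]
    exact ((splits_X_sq_sub_C (by rw [← sq, ha])).mul (splits_X_sq_sub_C (by rw [← sq, hb]))).mul
      (splits_X_sq_sub_C (by rw [← sq, hc]))
  -- hence an embedding `F4 → F`, bijective by degrees
  let φ : F4 →ₐ[ℚ] F := IsSplittingField.lift F4 F4.poly hs
  have hinj : Function.Injective φ.toLinearMap := φ.toRingHom.injective
  have hφ : Function.Bijective φ :=
    ⟨φ.toRingHom.injective, (LinearMap.injective_iff_surjective_of_finrank_eq_finrank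
      (by rw [F4.finrank_eq, hdeg])).mp hinj⟩
  let e : F4 ≃ₐ[ℚ] F := AlgEquiv.ofBijective φ hφ
  -- transport of points `E(F4) ≃+ E(F)`
  have hcomp : (e : F4 →ₐ[ℚ] F).comp (e.symm : F →ₐ[ℚ] F4) = AlgHom.id ℚ F :=
    AlgHom.ext fun x ↦ e.apply_symm_apply x
  have hid : ∀ (L : Type) [Field L] [Algebra ℚ L] (Q : (curve480a1.baseChange L).toAffine.Point),
      Affine.Point.map (AlgHom.id ℚ L) Q = Q := fun L _ _ Q ↦ by cases Q <;> rfl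
  let ψ : (curve480a1.baseChange F4).toAffine.Point ≃+ (curve480a1.baseChange F).toAffine.Point :=
    AddEquiv.ofBijective (Affine.Point.map (e : F4 →ₐ[ℚ] F))
      ⟨Affine.Point.map_injective (W' := curve480a1) _, fun Q ↦
        ⟨Affine.Point.map (e.symm : F →ₐ[ℚ] F4) Q, by rw [Affine.Point.map_map, hcomp, hid]⟩⟩
  unfold DokchitserDokchitser2011_descent_480a1_F4 WeierstrassCurve.mordellWeilRank
  unfold WeierstrassCurve.mordellWeilRank at hr
  rw [← hr]
  convert ψ.toIntLinearEquiv.finrank_eq using 2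

/-- The concrete descent leaf (`rk E(F4) = 6` for the tower model `F4`) and the tree's existential
`F₄` fact are equivalent. [cite: DokchitserDokchitser2011RankModN, proof of Thm. 2] -/
theorem DokchitserDokchitser2011_descent_480a1_F4_iff_rank :
    DokchitserDokchitser2011_descent_480a1_F4 ↔ DokchitserDokchitser2011_rank_480a1_F4 :=
  ⟨DokchitserDokchitser2011_rank_480a1_F4_of_descent, DokchitserDokchitser2011_descent_480a1_F4_of_rank⟩

end Existential

/-! ### Assembly -/

/-- **Conjunct (2) of the NARROWED record from the `F₄` descent leaf**: granting
`DokchitserDokchitser2011_descent_480a1_F4` (`rk 480a1(F₄) = 6`), the Mordell–Weil rank modulo `4`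
of elliptic curves over `ℚ` is not a sum over the places of `ℚ` of local invariants — Lemma 5 for
`(ℚ, F₄, 480a1)` (`not_isSumOfLocalInvariantsOver_rat_of_sum_twist_ne_zero`) with
`Λ = rk mod 4`, whose values on the eight twists sum to `6 ≡ 2 ≢ 0 (mod 4)`
(`sum_mordellWeilRank_twist_eq_six`).
[cite: DokchitserDokchitser2011RankModN, Lemma 5 and proof of Thm. 2] -/
theorem not_isSumOfLocalInvariantsOver_rat_rankMod_four_of_descent
    (h₄ : DokchitserDokchitser2011_descent_480a1_F4) :
    ¬ IsSumOfLocalInvariantsOver ℚ (fun W ↦ (W.mordellWeilRank : ZMod 4)) := by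
  refine not_isSumOfLocalInvariantsOver_rat_of_sum_twist_ne_zero dvd_rfl _ ?_
  rw [← Nat.cast_sum, sum_mordellWeilRank_twist_eq_six h₄]
  decide

/-- **Conjunct (2) of the NARROWED record from the tree's `F₄` fact**
`DokchitserDokchitser2011_rank_480a1_F4` (through `…_descent_480a1_F4_of_rank`).
[cite: DokchitserDokchitser2011RankModN, Lemma 5 and proof of Thm. 2] -/
theorem not_isSumOfLocalInvariantsOver_rat_rankMod_four_of_rank
    (h₄ : DokchitserDokchitser2011_rank_480a1_F4) :
    ¬ IsSumOfLocalInvariantsOver ℚ (fun W ↦ (W.mordellWeilRank : ZMod 4)) :=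
  not_isSumOfLocalInvariantsOver_rat_rankMod_four_of_descent
    (DokchitserDokchitser2011_descent_480a1_F4_of_rank h₄)

/-- The NARROWED record unfolds to: the entry AND its fixed-`ℚ` face modulo `4`. [folklore] -/
theorem DokchitserDokchitser2011_rankMod_notSumOfLocalInvariantsNarrow_iff :
    DokchitserDokchitser2011_rankMod_notSumOfLocalInvariantsNarrow ↔
      DokchitserDokchitser2011_rankMod_notSumOfLocalInvariants ∧
        ¬ IsSumOfLocalInvariantsOver ℚ (fun W ↦ (W.mordellWeilRank : ZMod 4)) :=
  Iff.rfl

/-- **The NARROWED record from the entry and the `F₄` fact.** Conjunct (1) is the entry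
`DokchitserDokchitser2011_rankMod_notSumOfLocalInvariants` (Thm. 2 of loc. cit.); conjunct (2) is
`not_isSumOfLocalInvariantsOver_rat_rankMod_four_of_rank`. Since the entry is itself reduced to
`DokchitserDokchitser2011_rank_480a1_F3/_F4/_F5` (`…_of_descent`), no hypothesis beyond the
entry's is used. [cite: DokchitserDokchitser2011RankModN, Thm. 2 and Lemma 5] -/
theorem DokchitserDokchitser2011_rankMod_notSumOfLocalInvariantsNarrow_of_entry_of_rank
    (h : DokchitserDokchitser2011_rankMod_notSumOfLocalInvariants)
    (h₄ : DokchitserDokchitser2011_rank_480a1_F4) :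
    DokchitserDokchitser2011_rankMod_notSumOfLocalInvariantsNarrow :=
  ⟨h, not_isSumOfLocalInvariantsOver_rat_rankMod_four_of_rank h₄⟩

/-- **The NARROWED record from the three descent computations** — the same named facts
`DokchitserDokchitser2011_rank_480a1_F3`, `…_F4`, `…_F5` ("2-descent shows that
`rk E/F₃ = rk E/F₅ = 1` and `rk E/F₄ = 6`", `E = 480a1`) from which the tree proves the entry
(`DokchitserDokchitser2011_rankMod_notSumOfLocalInvariants_of_descent`): everything else in the
printed argument — Lemma 3, Lemma 5, the fields, their splitting, the local block structure of
the eight twists and the rank bookkeeping `Σ_D rk E_D(ℚ) = rk E(F₄)` — is proved in the tree.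
The discharge `…Narrow_holds` is this theorem applied to the three `…_holds`, once they exist.
[cite: DokchitserDokchitser2011RankModN, Thm. 2 and Lemma 5] -/
theorem DokchitserDokchitser2011_rankMod_notSumOfLocalInvariantsNarrow_of_descent
    (h₃ : DokchitserDokchitser2011_rank_480a1_F3) (h₄ : DokchitserDokchitser2011_rank_480a1_F4)
    (h₅ : DokchitserDokchitser2011_rank_480a1_F5) :
    DokchitserDokchitser2011_rankMod_notSumOfLocalInvariantsNarrow :=
  DokchitserDokchitser2011_rankMod_notSumOfLocalInvariantsNarrow_of_entry_of_rank
    (DokchitserDokchitser2011_rankMod_notSumOfLocalInvariants_of_descent h₃ h₄ h₅) h₄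

end Literature.Barriers.BirchSwinnertonDyer

end
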